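import Summits.Ventures.PackingBounds.Configurations.LeechSectionShapes

/-!
# Laminated sections of the Leech kissing configuration, II: `93150`, `49896`, `27720` vectors (counts)

Framing: lottery ticket; floor = certified bounds/negative ranges. Venture `PackingBounds` (cell
`pub-packcert`, seat `pub-packcert-energy`).

The minimal vectors of the Leech lattice orthogonal to the minimal vector `x₀ = (4,4,0²²)`, to the `A₂`-pair
`x₀, x₁ = (4,0,4,0²¹)`, and to the `A₃`-triple `x₀, z₁ = (-4,0,4,0²¹), z₂ = (0,-4,0,4,0²⁰)` are the kissing
configurations of the laminated lattices `Λ₂₃, Λ₂₂, Λ₂₁` [Conway–Sloane, Ch. 6]; in coordinates the three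
conditions read `y₁ = -y₀`; `y₁ = y₂ = -y₀`; `y₁ = -y₀, y₂ = y₀, y₃ = -y₀`. This file COUNTS them
structurally (shape by shape, as in `LeechCard4600.lean`; the only kernel enumerations are over the `4096`
Golay messages, the `759` octads, the `128` sign patterns and the `1104` shape-`A` indices):
`|Λ₂₃-section| = 926 + 47168 + 45056 = 93150`, `|Λ₂₂-section| = 840 + 27552 + 21504 = 49896`,
`|Λ₂₁-section| = 760 + 16720 + 10240 = 27720` (`card_sec23`, `card_sec22`, `card_sec21`; the sections are `sec23`, `sec22`, `sec21`).
`Configurations/LeechSections.lean` turns them into kissing configurations of `ℝ²³, ℝ²², ℝ²¹`, i.e. the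
lower bounds `κ(23) ≥ 93150`, `κ(22) ≥ 49896` (still the records, Cohn–Li 2024 Table 1) and `κ(21) ≥ 27720` (Leech 1967;
superseded by Cohn–Li's `29768`, arXiv:2411.04916).

## References
* J. H. Conway, N. J. A. Sloane, *Sphere Packings, Lattices and Groups*, Ch. 6 (laminated lattices,
  Table 6.1) and Ch. 1 Table 1.2. [`ConwaySloane1999`]
-/

namespace Summit.Ventures.PackingBounds.Config.Leech

open Finset Golay

set_option maxRecDepth 100000 in
/-- Shape-`C` counts of the three sections. -/
theorem card_secC :
    ((univ ×ˢ range 4096).filter fun p : Fin 24 × ℕ => (cvec p.1 p.2) 0 + (cvec p.1 p.2) 1 = 0).card = 45056 ∧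
    ((univ ×ˢ range 4096).filter fun p : Fin 24 × ℕ => ((cvec p.1 p.2) 0 + (cvec p.1 p.2) 1 = 0 ∧ (cvec p.1 p.2) 0 + (cvec p.1 p.2) 2 = 0)).card = 21504 ∧
    ((univ ×ˢ range 4096).filter fun p : Fin 24 × ℕ => ((cvec p.1 p.2) 0 + (cvec p.1 p.2) 1 = 0 ∧ (cvec p.1 p.2) 2 - (cvec p.1 p.2) 0 = 0 ∧ (cvec p.1 p.2) 3 - (cvec p.1 p.2) 1 = 0)).card = 10240 := by
  refine ⟨?_, ?_, ?_⟩
  · rw [Finset.filter_congr (fun p hp => P23_cvec_iff p.1 (by simpa using hp)),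
      Finset.filter_product (fun i : Fin 24 => i ≠ 0 ∧ i ≠ 1) (fun u : ℕ => u.testBit 1 = !u.testBit 0),
      card_product]
    decide +kernel
  · rw [Finset.filter_congr (fun p hp => P22_cvec_iff p.1 (by simpa using hp)),
      Finset.filter_product (fun i : Fin 24 => i ≠ 0 ∧ i ≠ 1 ∧ i ≠ 2)
        (fun u : ℕ => u.testBit 1 = !u.testBit 0 ∧ u.testBit 2 = !u.testBit 0), card_product]
    decide +kernel
  · rw [Finset.filter_congr (fun p hp => P21_cvec_iff p.1 (by simpa using hp)),
      Finset.filter_product (fun i : Fin 24 => i ≠ 0 ∧ i ≠ 1 ∧ i ≠ 2 ∧ i ≠ 3)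
        (fun u : ℕ => u.testBit 1 = !u.testBit 0 ∧ u.testBit 2 = u.testBit 0 ∧ u.testBit 3 = !u.testBit 0),
      card_product]
    decide +kernel

set_option maxRecDepth 100000 in
/-- Octad counts through / avoiding the first coordinates (one kernel pass over the `759` octads). -/
theorem card_octads_prefix :
    (univ.filter fun o : Fin 759 => (0 : Fin 24) ∉ osupp o ∧ (1 : Fin 24) ∉ osupp o).card = 330 ∧
    (univ.filter fun o : Fin 759 => (0 : Fin 24) ∉ osupp o ∧ (1 : Fin 24) ∉ osupp o ∧ (2 : Fin 24) ∉ osupp o).card = 210 ∧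
    (univ.filter fun o : Fin 759 => (0 : Fin 24) ∈ osupp o ∧ (1 : Fin 24) ∈ osupp o ∧ (2 : Fin 24) ∈ osupp o).card = 21 ∧
    (univ.filter fun o : Fin 759 =>
      (0 : Fin 24) ∉ osupp o ∧ (1 : Fin 24) ∉ osupp o ∧ (2 : Fin 24) ∉ osupp o ∧ (3 : Fin 24) ∉ osupp o).card = 130 ∧
    (univ.filter fun o : Fin 759 =>
      (0 : Fin 24) ∈ osupp o ∧ (1 : Fin 24) ∈ osupp o ∧ (2 : Fin 24) ∈ osupp o ∧ (3 : Fin 24) ∈ osupp o).card = 5 := by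
  decide +kernel

set_option maxRecDepth 100000 in
/-- Sign-pattern counts. -/
theorem card_patterns_prefix :
    ((range 128).filter fun v => v.testBit 1 = !v.testBit 0).card = 64 ∧
    ((range 128).filter fun v => v.testBit 1 = !v.testBit 0 ∧ v.testBit 2 = !v.testBit 0).card = 32 ∧
    ((range 128).filter fun v => v.testBit 1 = !v.testBit 0 ∧ v.testBit 2 = v.testBit 0 ∧ v.testBit 3 = !v.testBit 0).card = 16 := by
  decide +kernel

/-- Counting a filter of the shape-`B` index set whose predicate is `(R₁ o) ∨ (R₂ o ∧ S v)` with `R₁, R₂` exclusive. -/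
theorem card_filter_or_product {R₁ R₂ : Fin 759 → Prop} {S : ℕ → Prop} [DecidablePred R₁] [DecidablePred R₂]
    [DecidablePred S] (hex : ∀ o, R₁ o → ¬ R₂ o) :
    ((univ ×ˢ range 128).filter fun p : Fin 759 × ℕ => R₁ p.1 ∨ (R₂ p.1 ∧ S p.2)).card =
      (univ.filter R₁).card * 128 + (univ.filter R₂).card * ((range 128).filter S).card := by
  rw [Finset.filter_or, card_union_eq_card_add_card.mpr, Finset.filter_product, card_product,
    Finset.filter_product_left, card_product, card_range]
  rw [Finset.disjoint_filter]
  rintro p _ h1 ⟨h2, _⟩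
  exact hex p.1 h1 h2

/-- Shape-`B` counts of the three sections. -/
theorem card_secB :
    ((univ ×ˢ range 128).filter fun p : Fin 759 × ℕ => (bvec p.1 p.2) 0 + (bvec p.1 p.2) 1 = 0).card = 47168 ∧
    ((univ ×ˢ range 128).filter fun p : Fin 759 × ℕ => ((bvec p.1 p.2) 0 + (bvec p.1 p.2) 1 = 0 ∧ (bvec p.1 p.2) 0 + (bvec p.1 p.2) 2 = 0)).card = 27552 ∧
    ((univ ×ˢ range 128).filter fun p : Fin 759 × ℕ => ((bvec p.1 p.2) 0 + (bvec p.1 p.2) 1 = 0 ∧ (bvec p.1 p.2) 2 - (bvec p.1 p.2) 0 = 0 ∧ (bvec p.1 p.2) 3 - (bvec p.1 p.2) 1 = 0)).card = 16720 := by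
  obtain ⟨c330, c210, c21, c130, c5⟩ := card_octads_prefix
  obtain ⟨p64, p32, p16⟩ := card_patterns_prefix
  refine ⟨?_, ?_, ?_⟩
  · rw [Finset.filter_congr (fun p _ => P23_bvec_iff p.1 p.2),
      card_filter_or_product (R₁ := fun o => (0 : Fin 24) ∉ osupp o ∧ (1 : Fin 24) ∉ osupp o)
        (R₂ := fun o => (0 : Fin 24) ∈ osupp o ∧ (1 : Fin 24) ∈ osupp o)
        (S := fun v => v.testBit 1 = !v.testBit 0) (fun o h1 h2 => h1.1 h2.1),
      c330, card_octads_01, p64]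
  · rw [Finset.filter_congr (fun p _ => P22_bvec_iff p.1 p.2),
      card_filter_or_product (R₁ := fun o => (0 : Fin 24) ∉ osupp o ∧ (1 : Fin 24) ∉ osupp o ∧ (2 : Fin 24) ∉ osupp o)
        (R₂ := fun o => (0 : Fin 24) ∈ osupp o ∧ (1 : Fin 24) ∈ osupp o ∧ (2 : Fin 24) ∈ osupp o)
        (S := fun v => v.testBit 1 = !v.testBit 0 ∧ v.testBit 2 = !v.testBit 0) (fun o h1 h2 => h1.1 h2.1),
      c210, c21, p32]
  · rw [Finset.filter_congr (fun p _ => P21_bvec_iff p.1 p.2),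
      card_filter_or_product
        (R₁ := fun o => (0 : Fin 24) ∉ osupp o ∧ (1 : Fin 24) ∉ osupp o ∧ (2 : Fin 24) ∉ osupp o ∧ (3 : Fin 24) ∉ osupp o)
        (R₂ := fun o => (0 : Fin 24) ∈ osupp o ∧ (1 : Fin 24) ∈ osupp o ∧ (2 : Fin 24) ∈ osupp o ∧ (3 : Fin 24) ∈ osupp o)
        (S := fun v => v.testBit 1 = !v.testBit 0 ∧ v.testBit 2 = v.testBit 0 ∧ v.testBit 3 = !v.testBit 0)
        (fun o h1 h2 => h1.1 h2.1),
      c130, c5, p16]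

/-! ### Shape `A` and the totals -/

set_option maxRecDepth 100000 in
/-- Shape-`A` counts of the three sections. -/
theorem card_secA :
    (idxA.filter fun p => (avec p.1.1 p.1.2 p.2.1 p.2.2) 0 + (avec p.1.1 p.1.2 p.2.1 p.2.2) 1 = 0).card = 926 ∧
    (idxA.filter fun p => ((avec p.1.1 p.1.2 p.2.1 p.2.2) 0 + (avec p.1.1 p.1.2 p.2.1 p.2.2) 1 = 0 ∧ (avec p.1.1 p.1.2 p.2.1 p.2.2) 0 + (avec p.1.1 p.1.2 p.2.1 p.2.2) 2 = 0)).card = 840 ∧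
    (idxA.filter fun p => ((avec p.1.1 p.1.2 p.2.1 p.2.2) 0 + (avec p.1.1 p.1.2 p.2.1 p.2.2) 1 = 0 ∧ (avec p.1.1 p.1.2 p.2.1 p.2.2) 2 - (avec p.1.1 p.1.2 p.2.1 p.2.2) 0 = 0 ∧ (avec p.1.1 p.1.2 p.2.1 p.2.2) 3 - (avec p.1.1 p.1.2 p.2.1 p.2.2) 1 = 0)).card = 760 := by
  rw [idxA]
  refine ⟨?_, ?_, ?_⟩ <;> decide +kernel

/-- The section counts, assembled over the three shapes. -/
theorem card_filter_leechInt (P : (Fin 24 → ℤ) → Prop) [DecidablePred P] {a b c : ℕ}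
    (hA : (idxA.filter fun p => P (avec p.1.1 p.1.2 p.2.1 p.2.2)).card = a)
    (hB : ((univ ×ˢ range 128).filter fun p : Fin 759 × ℕ => P (bvec p.1 p.2)).card = b)
    (hC : ((univ ×ˢ range 4096).filter fun p : Fin 24 × ℕ => P (cvec p.1 p.2)).card = c) :
    (leechInt.filter P).card = a + b + c := by
  have eA : (setA.filter P).card = a := by
    rw [setA, filter_image, card_image_of_injOn, hA]
    rintro ⟨⟨k, l⟩, ⟨a, b⟩⟩ hp ⟨⟨k', l'⟩, ⟨a', b'⟩⟩ hp' h
    have hkl : k < l := by have := (mem_filter.mp hp).1; simpa [idxA] using this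
    have hkl' : k' < l' := by have := (mem_filter.mp hp').1; simpa [idxA] using this
    obtain ⟨e1, e2, e3, e4⟩ := avec_inj hkl hkl' h
    subst e1 e2 e3 e4; rfl
  have eB : (setB.filter P).card = b := by
    rw [setB, filter_image, card_image_of_injOn, idxB, hB]
    rintro ⟨o, v⟩ hp ⟨o', v'⟩ hp' h
    have hv : v < 128 := by have := (mem_filter.mp hp).1; simpa [idxB] using this
    have hv' : v' < 128 := by have := (mem_filter.mp hp').1; simpa [idxB] using this
    obtain ⟨e1, e2⟩ := bvec_inj hv hv' h
    subst e1 e2; rfl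
  have eC : (setC.filter P).card = c := by
    rw [setC, filter_image, card_image_of_injOn, idxC, hC]
    rintro ⟨i, u⟩ hp ⟨i', u'⟩ hp' h
    have hu : u < 4096 := by have := (mem_filter.mp hp).1; simpa [idxC] using this
    have hu' : u' < 4096 := by have := (mem_filter.mp hp').1; simpa [idxC] using this
    obtain ⟨e1, e2⟩ := cvec_inj hu hu' h
    subst e1 e2; rfl
  rw [leechInt, filter_union, filter_union, card_union_eq_card_add_card.mpr, card_union_eq_card_add_card.mpr,
    eA, eB, eC]
  · exact disjoint_setA_setB.mono (filter_subset _ _) (filter_subset _ _)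
  · rw [← filter_union]
    refine Disjoint.mono (filter_subset _ _) (filter_subset _ _) ?_
    exact disjoint_union_left.mpr ⟨disjoint_setA_setC, disjoint_setB_setC⟩

/-- The `Λ₂₃`-section of the Leech minimal vectors (orthogonal to `x₀`). -/
noncomputable def sec23 : Finset (Fin 24 → ℤ) := leechInt.filter fun y => y 0 + y 1 = 0

/-- The `Λ₂₂`-section of the Leech minimal vectors (orthogonal to `x₀, x₁`). -/
noncomputable def sec22 : Finset (Fin 24 → ℤ) := leechInt.filter fun y => y 0 + y 1 = 0 ∧ y 0 + y 2 = 0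

/-- The `Λ₂₁`-section of the Leech minimal vectors (orthogonal to `x₀, z₁, z₂`). -/
noncomputable def sec21 : Finset (Fin 24 → ℤ) :=
  leechInt.filter fun y => y 0 + y 1 = 0 ∧ y 2 - y 0 = 0 ∧ y 3 - y 1 = 0

attribute [irreducible] sec23 sec22 sec21

/-- **`|Λ₂₃|`-section: `93150` Leech minimal vectors are orthogonal to `x₀`.** [cite: ConwaySloane1999, Ch. 6 Table 6.1] -/
theorem card_sec23 : sec23.card = 93150 := by
  rw [sec23, card_filter_leechInt (fun y => y 0 + y 1 = 0) card_secA.1 card_secB.1 card_secC.1]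

/-- **`|Λ₂₂|`-section: `49896` Leech minimal vectors are orthogonal to `x₀, x₁`.** [cite: ConwaySloane1999, Ch. 6 Table 6.1] -/
theorem card_sec22 : sec22.card = 49896 := by
  rw [sec22, card_filter_leechInt (fun y => y 0 + y 1 = 0 ∧ y 0 + y 2 = 0) card_secA.2.1 card_secB.2.1 card_secC.2.1]

/-- **`|Λ₂₁|`-section: `27720` Leech minimal vectors are orthogonal to `x₀, z₁, z₂`.** [cite: ConwaySloane1999, Ch. 6 Table 6.1] -/
theorem card_sec21 : sec21.card = 27720 := by
  rw [sec21, card_filter_leechInt (fun y => y 0 + y 1 = 0 ∧ y 2 - y 0 = 0 ∧ y 3 - y 1 = 0) card_secA.2.2 card_secB.2.2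
    card_secC.2.2]

end Summit.Ventures.PackingBounds.Config.Leech
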